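import Mathlib
import Literature.AlgebraicGeometry.Resolution.AffineBlowupAlgebra
import Literature.AlgebraicGeometry.Resolution.BlowupChartRsop

/-!
# Rung V3 (one blow-up model): chart criteria, and the chart `D₊(x_a⁴ t)` (A) of `Bl_{K₃} 𝔸ⁿ` is an affine space

(crux stmt-ResolutionOfSingularities-15640 `WildQuotients.WildQuotientResolution`, line `Sketch`,
sector `|G| = p`; rung V3 of `L/w45c/CHAIN.md` v4, ONE-BLOW-UP design of record (lead-1 RULING
2026-08-27T01:07:58Z); part (b) of stub-4's split, chart `j = 0` (A) here, `j = 1` (B2a) in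
`…JordanThreeChartB2a`; stub-2 does `j = 3` (B2b), `j = 4` (B1). [OURS · L1 W4.5c] — NOT a statement of any manuscript; replaces
the role of no printed item.)

`K₃ = (x_a⁴, x_a³x_b, x_a²x_b³, x_a x_b⁴, x_b⁶) ⊆ k[x₁,…,xₙ]` (generator vector of record
`![X a ^ 4, X a ^ 3 * X b, X a ^ 2 * X b ^ 3, X a * X b ^ 4, X b ^ 6]`, `a ≠ b`). Its blow-up is the
smooth toric modification of the `(x_a,x_b)`-plane by the fan with rays `(1,1), (2,1), (3,2)`
(times `𝔸ⁿ⁻²`); the chart rings at the Newton vertices are polynomial rings: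

* chart A = `D₊(x_a⁴ t)`: `k[x][K₃/x_a⁴] = k[x_a, t = x_b/x_a, rest]` (`x_b = x_a t`);
* chart B2a = `D₊(x_a³x_b t)`: `k[x][K₃/x_a³x_b] = k[u = x_a/x_b, y = x_b³/x_a², rest]`
  (`x_a = u³y`, `x_b = u²y`).

Content: two GENERIC lemmas (`range_eq_blowupAlgebra_of_chart`: a ring map into `R[1/c_j]` whose
range contains `R` and the `c_i/c_j` and is contained in `R[I/c_j]` has range `R[I/c_j]`;
`isRegularRing_chartRing_of_chart`: an injective such map from a regular ring makes the chart ring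
`(R[It])_{(c_j t)} ≅ R[I/c_j]` (`reesChartEquiv`) regular), then chart A by the pattern of
`Literature.…CoordinateBlowupChart`: an explicit `aeval` chart map, injective because the blow-up
substitution extends to `R[1/c_j]` and retracts it onto the (injective) localisation map.
`IsRegularRing (chartRing c j)` for the four Newton-vertex charts are the inputs of part (c)
(`Scheme.IsRegular (affineBlowup K₃)` by the cover `AffineBlowupRegular` pattern).
-/

-- single-problem summit: the doubled namespace component `ResolutionOfSingularities` is forced
set_option linter.dupNamespace false

noncomputable section

open MvPolynomial IsLocalization
open Literature.AlgebraicGeometry.Resolution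

namespace Summit.ResolutionOfSingularities.ResolutionOfSingularities.Theorems.WildQuotientResolution.JordanThree

universe u

/-! ## Generic chart criteria -/

/-- **Range criterion for a chart of an affine blow-up.** Let `I = (c_0,…,c_{m-1}) ⊆ R` and
`φ : A → R[1/c_j]` a ring map whose values lie in the affine blowup algebra `R[I/c_j]`, whose
range contains the image of `R` and the fractions `c_i/c_j`. Then `range φ = R[I/c_j]`.
[cite: StacksProject, Tag 052Q] [folklore] -/
theorem range_eq_blowupAlgebra_of_chart {R A : Type u} [CommRing R] [CommRing A] {m : ℕ}
    (c : Fin m → R) (j : Fin m) (φ : A →+* Localization.Away (c j))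
    (hmem : ∀ x, φ x ∈ blowupAlgebra (Ideal.span (Set.range c)) (c j))
    (hbase : ∀ r : R, algebraMap R (Localization.Away (c j)) r ∈ Set.range φ)
    (hgen : ∀ i : Fin m, algebraMap R (Localization.Away (c j)) (c i) *
      IsLocalization.Away.invSelf (c j) ∈ Set.range φ) :
    Set.range φ = (blowupAlgebra (Ideal.span (Set.range c)) (c j) :
      Set (Localization.Away (c j))) := by
  apply le_antisymm
  · rintro _ ⟨x, rfl⟩
    exact hmem x
  · -- the range is an `R`-subalgebra containing the generators `x / c_j`, `x ∈ I`
    let B : Subalgebra R (Localization.Away (c j)) :=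
      { carrier := Set.range φ
        mul_mem' := by
          rintro _ _ ⟨p, rfl⟩ ⟨q, rfl⟩
          exact ⟨p * q, map_mul _ _ _⟩
        one_mem' := ⟨1, map_one _⟩
        add_mem' := by
          rintro _ _ ⟨p, rfl⟩ ⟨q, rfl⟩
          exact ⟨p + q, map_add _ _ _⟩
        zero_mem' := ⟨0, map_zero _⟩
        algebraMap_mem' := fun r => hbase r }
    change (blowupAlgebra (Ideal.span (Set.range c)) (c j) : Set (Localization.Away (c j))) ⊆
      (B : Set (Localization.Away (c j)))
    have hle : blowupAlgebra (Ideal.span (Set.range c)) (c j) ≤ B := by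
      refine Algebra.adjoin_le ?_
      rintro _ ⟨x, hx, rfl⟩
      refine Submodule.span_induction (p := fun x _ =>
        algebraMap R (Localization.Away (c j)) x * Away.invSelf (c j) ∈ B) ?_ ?_ ?_ ?_ hx
      · rintro _ ⟨i, rfl⟩
        exact hgen i
      · rw [map_zero, zero_mul]
        exact B.zero_mem
      · intro x y _ _ hx hy
        rw [map_add, add_mul]
        exact B.add_mem hx hy
      · intro r x _ hx
        rw [smul_eq_mul, map_mul, mul_assoc]
        exact B.mul_mem (B.algebraMap_mem r) hx
    exact hle

/-- **Regularity criterion for a chart of an affine blow-up.** If an injective ring map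
`φ : A → R[1/c_j]` from a regular ring `A` has range exactly the affine blowup algebra
`R[I/c_j]`, `I = (c_0,…,c_{m-1})`, then the chart ring `(R[It])_{(c_j t)}` of
`Bl_I(Spec R) = Proj R[It]` (`chartRing c j`, isomorphic to `R[I/c_j]` by `reesChartEquiv`) is a
regular ring. [cite: StacksProject, Tag 0804] [folklore] -/
theorem isRegularRing_chartRing_of_chart {R A : Type u} [CommRing R] [CommRing A]
    [IsRegularRing A] {m : ℕ} (c : Fin m → R) (j : Fin m)
    (φ : A →+* Localization.Away (c j)) (hinj : Function.Injective φ)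
    (hrange : Set.range φ = (blowupAlgebra (Ideal.span (Set.range c)) (c j) :
      Set (Localization.Away (c j)))) :
    IsRegularRing (chartRing c j) := by
  have hmem : ∀ x, φ x ∈ (blowupAlgebra (Ideal.span (Set.range c)) (c j)).toSubring := by
    intro x
    have hx : φ x ∈ Set.range φ := ⟨x, rfl⟩
    rw [hrange] at hx
    exact hx
  let ψ : A →+* blowupAlgebra (Ideal.span (Set.range c)) (c j) := φ.codRestrict _ hmem
  have hψ : Function.Bijective ψ := by
    refine ⟨fun x y h => hinj (congrArg Subtype.val h), fun z => ?_⟩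
    have hz : (z : Localization.Away (c j)) ∈ Set.range φ := by
      rw [hrange]
      exact z.2
    obtain ⟨x, hx⟩ := hz
    exact ⟨x, Subtype.ext hx⟩
  let e : A ≃+* chartRing c j :=
    (RingEquiv.ofBijective ψ hψ).trans
      (reesChartEquiv (c j) (Ideal.mem_span_range_self (f := c) (x := j))).symm
  exact IsRegularRing.of_ringEquiv e

/-! ## The `K₃` charts A and B2a -/

section Charts

variable (k : Type) [Field k] (n : ℕ) (a b : Fin n)

/-- In `R[1/g]`: `(g x)/1 · (1/g) = x/1`. [folklore] -/
theorem algebraMap_mul_mul_invSelf {R : Type u} [CommRing R] (g x : R) :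
    algebraMap R (Localization.Away g) (g * x) * Away.invSelf g =
      algebraMap R (Localization.Away g) x := by
  rw [map_mul, mul_assoc, mul_comm _ (Away.invSelf g), ← mul_assoc, Away.mul_invSelf, one_mul]

/-- The localisation map `k[x] → k[x][1/g]` is injective for `g ≠ 0`. [folklore] -/
theorem algebraMap_away_injective (g : MvPolynomial (Fin n) k) (hg : g ≠ 0) :
    Function.Injective
      (algebraMap (MvPolynomial (Fin n) k) (Localization.Away g)) :=
  IsLocalization.injective (Localization.Away g) (M := Submonoid.powers g)
    (powers_le_nonZeroDivisors_of_noZeroDivisors hg)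

/-! ### Chart A = `D₊(x_a⁴ t)`: coordinates `x_a`, `t = x_b/x_a` -/

/-- **Chart A of `Bl_{K₃} 𝔸ⁿ` is regular**: the chart ring `(R[K₃t])_{(x_a⁴ t)}` is the polynomial
ring `k[x_a, t, rest]` via `x_b = x_a t` (`t = x_a³x_b / x_a⁴`), in particular a regular ring.
[folklore; toric chart of the cone `⟨(1,1),(0,1)⟩`] -/
theorem isRegularRing_chartRing_k3_zero (hab : a ≠ b) :
    IsRegularRing (chartRing
      (![X a ^ 4, X a ^ 3 * X b, X a ^ 2 * X b ^ 3, X a * X b ^ 4, X b ^ 6] :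
        Fin 5 → MvPolynomial (Fin n) k) 0) := by
  classical
  -- notation
  let c : Fin 5 → MvPolynomial (Fin n) k :=
    ![X a ^ 4, X a ^ 3 * X b, X a ^ 2 * X b ^ 3, X a * X b ^ 4, X b ^ 6]
  let L := Localization.Away (c 0)
  let am : MvPolynomial (Fin n) k →+* L := algebraMap _ L
  let ι : L := Away.invSelf (c 0)
  have hinv : am (X a) ^ 4 * ι = 1 := by
    rw [← map_pow]
    exact Away.mul_invSelf (S := L) (c 0)
  haveI : IsRegularRing (MvPolynomial (Fin n) k) := MvPolynomial.isRegularRing_of_isRegularRing k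
  -- the chart map `x_b ↦ x_b/x_a = (x_a³x_b)/x_a⁴`, identity on the other variables
  let v : Fin n → L := fun i => if i = b then am (X a ^ 3 * X b) * ι else am (X i)
  let φ : MvPolynomial (Fin n) k →ₐ[k] L := aeval v
  have hφb : φ (X b) = am (X a ^ 3 * X b) * ι := by simp [φ, v]
  have hφi : ∀ i, i ≠ b → φ (X i) = am (X i) := fun i hi => by simp [φ, v, hi]
  have hφa : φ (X a) = am (X a) := hφi a hab
  have hφC : ∀ r : k, φ (C r) = am (C r) := by
    intro r
    rw [← MvPolynomial.algebraMap_eq, AlgHom.commutes]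
    rfl
  -- the substitution `x_b ↦ x_a x_b`
  let w : Fin n → MvPolynomial (Fin n) k := fun i => if i = b then X a * X b else X i
  let θ : MvPolynomial (Fin n) k →ₐ[k] MvPolynomial (Fin n) k := aeval w
  have hθb : θ (X b) = X a * X b := by simp [θ, w]
  have hθi : ∀ i, i ≠ b → θ (X i) = X i := fun i hi => by simp [θ, w, hi]
  have hθC : ∀ r : k, θ (C r) = C r := fun r => by
    rw [← MvPolynomial.algebraMap_eq]
    exact θ.commutes r
  -- chart ∘ substitution = localisation map
  have hφθ' : (φ : MvPolynomial (Fin n) k →+* L).comp (θ : MvPolynomial (Fin n) k →+* _) = am := by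
    refine MvPolynomial.ringHom_ext (fun r => ?_) (fun i => ?_)
    · simp only [RingHom.coe_comp, RingHom.coe_coe, Function.comp_apply, hθC, hφC]
    · simp only [RingHom.coe_comp, RingHom.coe_coe, Function.comp_apply]
      by_cases hi : i = b
      · rw [hi, hθb, map_mul, hφa, hφb, ← mul_assoc, ← map_mul]
        have e : X a * (X a ^ 3 * X b) = c 0 * X b := by
          change _ = X a ^ 4 * X b
          ring
        rw [e]
        exact algebraMap_mul_mul_invSelf (c 0) (X b)
      · rw [hθi i hi, hφi i hi]
  have hφθ : ∀ r, φ (θ r) = am r := fun r => RingHom.congr_fun hφθ' r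
  -- injectivity: the substitution extends to `R[1/x_a⁴]` and retracts the chart map
  have hunit : IsUnit ((am.comp (θ : MvPolynomial (Fin n) k →+* _)) (c 0)) := by
    change IsUnit (am (θ (X a ^ 4)))
    have e : θ (X a ^ 4) = X a ^ 4 := by rw [map_pow, hθi a hab]
    rw [e]
    exact IsLocalization.Away.algebraMap_isUnit (S := L) (c 0)
  let Θ : L →+* L := IsLocalization.Away.lift (c 0) hunit
  have hΘam : ∀ r, Θ (am r) = am (θ r) := fun r => IsLocalization.Away.lift_eq (c 0) hunit r
  have hΘι : am (X a) ^ 4 * Θ ι = 1 := by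
    have h : Θ (am (c 0) * ι) = 1 := by rw [Away.mul_invSelf, map_one]
    rw [map_mul, hΘam] at h
    change am (θ (X a ^ 4)) * Θ ι = 1 at h
    rwa [map_pow, hθi a hab, map_pow] at h
  have hΘφ' : Θ.comp (φ : MvPolynomial (Fin n) k →+* L) = am := by
    refine MvPolynomial.ringHom_ext (fun r => ?_) (fun i => ?_)
    · simp only [RingHom.coe_comp, RingHom.coe_coe, Function.comp_apply, hφC, hΘam, hθC]
    · simp only [RingHom.coe_comp, RingHom.coe_coe, Function.comp_apply]
      by_cases hi : i = b
      · rw [hi, hφb, map_mul, hΘam]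
        simp only [map_mul, map_pow, hθi a hab, hθb]
        linear_combination (am (X b)) * hΘι
      · rw [hφi i hi, hΘam, hθi i hi]
  have hΘφ : ∀ r, Θ (φ r) = am r := fun r => RingHom.congr_fun hΘφ' r
  have hinj : Function.Injective (φ : MvPolynomial (Fin n) k →+* L) := by
    intro p q hpq
    apply algebraMap_away_injective k n (c 0) (pow_ne_zero 4 (X_ne_zero a))
    change am p = am q
    rw [← hΘφ p, ← hΘφ q]
    exact congrArg Θ hpq
  -- values in the blowup algebra
  have hmem : ∀ p, (φ : MvPolynomial (Fin n) k →+* L) p ∈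
      blowupAlgebra (Ideal.span (Set.range c)) (c 0) := by
    intro p
    induction p using MvPolynomial.induction_on with
    | C r =>
      rw [RingHom.coe_coe, hφC]
      exact Subalgebra.algebraMap_mem _ _
    | add p q hp hq =>
      rw [map_add]
      exact Subalgebra.add_mem _ hp hq
    | mul_X p i hp =>
      rw [map_mul]
      refine Subalgebra.mul_mem _ hp ?_
      by_cases hi : i = b
      · rw [hi, RingHom.coe_coe, hφb]
        exact div_mem_blowupAlgebra _ _ (Ideal.subset_span ⟨1, rfl⟩)
      · rw [RingHom.coe_coe, hφi i hi]
        exact Subalgebra.algebraMap_mem _ _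
  -- the generators `c_i / x_a⁴` are values of the chart map
  have hgen : ∀ i : Fin 5, am (c i) * ι ∈ Set.range (φ : MvPolynomial (Fin n) k →+* L) := by
    intro i
    fin_cases i
    · exact ⟨1, by rw [map_one]; exact (Away.mul_invSelf (S := L) (c 0)).symm⟩
    · exact ⟨X b, by rw [RingHom.coe_coe, hφb]; rfl⟩
    · refine ⟨X a * X b ^ 3, ?_⟩
      rw [RingHom.coe_coe, map_mul, map_pow, hφa, hφb]
      change _ = am (X a ^ 2 * X b ^ 3) * ι
      simp only [map_mul, map_pow]
      linear_combination (am (X a) ^ 2 * am (X b) ^ 3 * ι * (am (X a) ^ 4 * ι + 1)) * hinv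
    · refine ⟨X a * X b ^ 4, ?_⟩
      rw [RingHom.coe_coe, map_mul, map_pow, hφa, hφb]
      change _ = am (X a * X b ^ 4) * ι
      simp only [map_mul, map_pow]
      linear_combination (am (X a) * am (X b) ^ 4 * ι *
        ((am (X a) ^ 4 * ι) ^ 2 + am (X a) ^ 4 * ι + 1)) * hinv
    · refine ⟨X a ^ 2 * X b ^ 6, ?_⟩
      rw [RingHom.coe_coe, map_mul, map_pow, map_pow, hφa, hφb]
      change _ = am (X b ^ 6) * ι
      simp only [map_mul, map_pow]
      linear_combination (am (X b) ^ 6 * ι * ((am (X a) ^ 4 * ι) ^ 4 + (am (X a) ^ 4 * ι) ^ 3 +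
        (am (X a) ^ 4 * ι) ^ 2 + am (X a) ^ 4 * ι + 1)) * hinv
  have hrange := range_eq_blowupAlgebra_of_chart c 0 (φ : MvPolynomial (Fin n) k →+* L) hmem
    (fun r => ⟨θ r, hφθ r⟩) hgen
  exact isRegularRing_chartRing_of_chart c 0 (φ : MvPolynomial (Fin n) k →+* L) hinj hrange

end Charts

end Summit.ResolutionOfSingularities.ResolutionOfSingularities.Theorems.WildQuotientResolution.JordanThree

end
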